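import Summits.BirchSwinnertonDyer.Rank1Residual.X11b.KolyvaginH44OfTraceRelation
import Literature.NumberTheory.EllipticCurves.HeegnerPointsKolyvaginPrimaryPointsProofs
import HarnessLib

/-!
# `[P_m]` is fixed by `𝒢_m` modulo `p^M` (McCallum 1991, (4); Gross 1991, Prop. 3.6) for the tree's
# concrete Heegner data at a Kolyvagin level — the END binders `hPt` and `hord` SUPPLIED

Cell `b2b-bsdres`, team x11b3 (N8/O2), `h44` programme (lead GEN 9, offer (P4-A) of x11b3-p4 GEN 6,
complementary to R10-34 (2)).  Summit-side THEOREM-ONLY file (no definition, no named fact, no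
`sorry`); `K : Type`; nothing is `p = 3`-specific (`p` odd or even, any `M ≥ 1`).

HONEST FRAMING (binding): **plumbing.**  Of the labelled remainder
{`hA`, `hPt`, `hI`, `hord`, `hfsec`, `hfS`, `hHρ`} + {`hγ`, `hD`} of the consumer END
`KolyvaginH44.h44_of_traceRelation_of_congruence_of_dvd` (x11b3-p2, `X11b/KolyvaginH44OfTraceRelation`)
read at concrete currency, this file SUPPLIES `hPt` (McCallum's (4) = Gross's Prop. 3.6: *"the class
`[P_n]` in `E(K_n)/p E(K_n)` is fixed by `𝒢_n`"*) and `hord` (`σ_ℓ^{ℓ+1} = 1`) at every divisor `m`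
of a square-free top level `n` all of whose prime factors are Kolyvagin primes of level `M`
(`IsKolyvaginPrime N W K p q ∧ FrobEqFrobInfty W K (p^M) q`), for ANY family of concrete data
`d m hm : KolyvaginHeegnerData Dt β ι m` (coherence across levels is NOT needed here), from LANDED
tree theorems only:

* (β2) = Gross Prop. 3.7 (1) `Tr_ℓ y(m) = a_ℓ · y(m/ℓ)` PROVED for the tree's data (x11b3-p2
  `HeegnerTrace.sum_pow_pointGalHom_y_eq_lFunction_smul_map`), transferred to the abstract module
  `A₀ m` along the dictionary `iA m` exactly as in x11b3-p8's bridge `KolyvaginH37Bridge`;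
* (3.3) = `p^M ∣ ℓ + 1`, `p^M ∣ a_ℓ` PROVED (`IsKolyvaginPrime.pow_dvd_add_one`,
  `pow_dvd_frobeniusTraceAt_of_frobEqFrobInfty`, `HeegnerPointsKolyvaginPrimaryCongruenceProofs`);
* "`G_m ≃ ∏ G_ℓ`" (Gross 1991, §3, chunk 217 L1) on the Galois side: `Gal(K[m]/K[1])` is generated
  by the `G_ℓ = Gal(K[m]/K[m] ∩ K[m/ℓ])`, `ℓ ∣ m` — from x11b3-lit2's group-tower lemma
  `RingClass.ker_restrict_div_le_sup` through x11b3-p8's Artin dictionary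
  (`RingClassTower.ringClassGalOver_le_sup`, `exists_mul_eq_of_restrict_div_eq_one`), by induction
  over the prime factors (`ringClassGalOver_div_le_iSup`, `ringClassGalOver_one_le_iSup` below);
* the group-ring algebra of Gross §3 / McCallum §4 already in the tree
  (`KolyvaginEuler.smul_kolyvaginPoint_sub_mem`, `KolyvaginEuler.map_mem_invPoints_of_forall_smul_sub_mem`).

`h44` / (γ) / `h37`-in-general are NOT discharged; `hA` (admissibility, Gross Lemma 4.3) and `hI`
(McCallum Lemma 4.3) are untouched; the class record / (t) / node are unchanged; nothing is booked;
no mark / label / count moves.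

## What is proved

* `RingClassTower.ringClassGalOver_self_le` — `Gal(K[n]/K[n] ∩ K[n])` is trivial.
* `RingClassTower.ringClassGalOver_div_le_sup_of_squarefree` — for `n` square-free and a prime
  `q ∣ m ∣ n`: `Gal(K[n]/K[n] ∩ K[m/q]) ≤ G_q ⊔ Gal(K[n]/K[n] ∩ K[m])` (the hypothesis `hG1` of
  `ringClassGalOver_le_sup` DISCHARGED by `exists_mul_eq_of_restrict_div_eq_one`).
* `RingClassTower.ringClassGalOver_div_le_iSup`, **`RingClassTower.ringClassGalOver_one_le_iSup`** —
  `G_n = Gal(K[n]/K[1]) ≤ ⨆_{q ∣ n} G_q` for `n` square-free ("`G_n ≃ ∏ G_ℓ`", Galois side).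
* `KolyvaginH44.not_dvd_div_of_squarefree_of_prime` — `ℓ ∤ m/ℓ` for `m` square-free (helper).
* `KolyvaginH44.pow_succ_eq_one_of_dvd` — the END binder **`hord`** at the divisors of `n`.
* `KolyvaginH44.le_closure_of_dvd` — the Euler hypothesis `hgen : H m ≤ ⟨σ_m ℓ : ℓ ∣ m⟩` at the
  divisors of `n`.
* `KolyvaginH44.grAct_traceElt_mem_of_dvd` — `Tr_ℓ y_m ∈ p^M A₀ m` at the divisors of a Kolyvagin
  level of level `M` ((β2) + (3.3)).
* `KolyvaginH44.smul_kolyvaginPoint_sub_mem_of_dvd` — **McCallum's (4)**: `γ P_m − P_m ∈ p^M A₀ m`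
  for every `γ ∈ 𝒢_m`, at every `m ∣ n`.
* **`KolyvaginH44.kolyvaginPoint_mem_invPoints_of_dvd`** — the END binder **`hPt`** at the divisors
  of `n`: `j_m P_m ∈ invPoints Γ_K (j_m A₀ m) p^M` (the text of `hPt m` verbatim).

## References

* [GrossLMS1991] B. H. Gross, *Kolyvagin's work on modular elliptic curves*, in *L-functions and
  Arithmetic*, LMS LNS 153 (1991): §3 (3.1)–(3.5), Prop. 3.6, Prop. 3.7 (1), the field diagram and
  "`G_n ≃ ∏ G_ℓ`" (held `book:editornd-l-functions-arithmetic`, PDF p. 216, chunk 217 L1), §4 (4.1).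
* [McCallumLMS1991] W. G. McCallum, *Kolyvagin's work on Shafarevich–Tate groups*, same volume,
  §4 ((4), p. 281–282).
* [Cox2013] D. A. Cox, *Primes of the form x² + ny²*, 2nd ed., §7.D (7.27), §9.A.

## Mathlib / tree search

Tree: `KolyvaginEuler.{kolyvaginPoint, grAct, traceElt, grAct_traceElt, grAct_traceElt_mem_of_eq_smul,
smul_kolyvaginPoint_sub_mem, map_mem_invPoints_of_forall_smul_sub_mem, zsmulRange}`,
`KolyvaginCocycle.invPoints`, `HeegnerTrace.sum_pow_pointGalHom_y_eq_lFunction_smul_map`,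
`HeegnerTrace.frobeniusTrace_smul_eq_of_lFunction_smul_eq`,
`KolyvaginH37Bridge.hasGoodReductionAtPrime_of_modularParametrizationData`,
`KolyvaginH37Bridge.coprime_of_forall_not_dvd`, `KolyvaginH44.exists_ratPlace`,
`IsKolyvaginPrime.pow_dvd_add_one`, `pow_dvd_frobeniusTraceAt_of_frobEqFrobInfty`,
`frobeniusTraceAt_eq_frobeniusTrace`, `hasGoodReductionAt_of_isNewformOf_of_not_dvd`,
`RingClassTower.{ringClassGalOver_le_sup, exists_mul_eq_of_restrict_div_eq_one,
pow_succ_eq_one_of_mem_ringClassGalOver}`, `ringClassField_mono`, `KolyvaginHeegnerData.zpowers_σ`.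
Mathlib: `induction_on_primes`, `Subgroup.mem_sup`, `le_iSup₂_of_le`, `iSup₂_le`,
`MonoidHom.map_closure`, `Subgroup.closure_le`, `mem_fixingSubgroup_iff`.
`lean search 'KolyvaginPointClassFixed|kolyvaginPoint_mem_invPoints_of_dvd|ringClassGalOver_one_le'`
→ no matches (INTENT-grep).
-/

noncomputable section

open scoped Classical
open WeierstrassCurve Field NumberField IsDedekindDomain Finset
open Literature.NumberTheory.EllipticCurves Literature.NumberTheory.GaloisRepresentations
open Literature.NumberTheory.EllipticCurves.KolyvaginCocycle
open Literature.NumberTheory.EllipticCurves.KolyvaginEuler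
open Literature.NumberTheory.EllipticCurves.RingClassField
open Literature.NumberTheory.EllipticCurves.ModularForms

/-! ## §1 "`G_n ≃ ∏ G_ℓ`" on the Galois side: `Gal(K[n]/K[1])` is generated by the `G_ℓ` -/

namespace Summit.BirchSwinnertonDyer.Rank1Residual.X11b.RingClassTower

-- `K : Type`: the tree's ring-class class field theory is universe `0`.
variable {K : Type} [Field K] [NumberField K]

/-- `Gal(K[n]/K[n] ∩ K[n])` is trivial: it lies in every subgroup. [folklore] -/
theorem ringClassGalOver_self_le (ι : K →+* ℂ) (n : ℕ)
    (S : Subgroup (ringClassField K ι n ≃ₐ[ℚ] ringClassField K ι n)) :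
    ringClassGalOver ι n n ≤ S := by
  intro g hg
  have h1 : g = 1 := AlgEquiv.ext fun x =>
    (_root_.mem_fixingSubgroup_iff
      (M := ringClassField K ι n ≃ₐ[ℚ] ringClassField K ι n)).mp hg x (SetLike.coe_mem x)
  rw [h1]
  exact S.one_mem

/-- **`Gal(K[n]/K[n] ∩ K[m/q]) ≤ G_q · Gal(K[n]/K[n] ∩ K[m])`** for `n` square-free and a prime
`q ∣ m ∣ n`, with `G_q = Gal(K[n]/K[n] ∩ K[n/q])` — x11b3-p8's `ringClassGalOver_le_sup` with its
group-tower hypothesis `hG1` DISCHARGED by x11b3-lit2's `RingClass.ker_restrict_div_le_sup` (element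
form `exists_mul_eq_of_restrict_div_eq_one`): on the field side, `K[m] ∩ K[n/q] = K[m/q]`.
[cite: GrossLMS1991, §3 (chunk 217 L1)] [cite: Cox2013, §7.D (7.27)] -/
theorem ringClassGalOver_div_le_sup_of_squarefree (hK : IsImaginaryQuadratic K) (ι : K →+* ℂ)
    {q m n : ℕ} (hsq : Squarefree n) (hqm : q ∣ m) (hmn : m ∣ n) (hq : q.Prime) :
    ringClassGalOver ι n (m / q) ≤ ringClassGalOver ι n (n / q) ⊔ ringClassGalOver ι n m :=
  ringClassGalOver_le_sup hK ι hsq.ne_zero (Nat.div_dvd_of_dvd (hqm.trans hmn)) hmn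
    ((Nat.div_dvd_of_dvd hqm).trans hmn)
    (fun x hx => exists_mul_eq_of_restrict_div_eq_one hK.1 hsq hqm hmn hq x hx)

/-- **`Gal(K[n]/K[n] ∩ K[n/k]) ≤ ⨆_{q ∣ n} G_q`** for `n` square-free and `k ∣ n`, by induction on
the prime factorisation of `k` (Gross 1991, §3: "`G_n ≃ ∏ G_ℓ` where, for each `ℓ ∣ n`, `G_ℓ` is
the subgroup fixing the subfield `K_{n/ℓ}`"). [cite: GrossLMS1991, §3 (chunk 217 L1)] -/
theorem ringClassGalOver_div_le_iSup (hK : IsImaginaryQuadratic K) (ι : K →+* ℂ) {n : ℕ}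
    (hsq : Squarefree n) {k : ℕ} (hk : k ∣ n) :
    ringClassGalOver ι n (n / k) ≤ ⨆ q ∈ n.primeFactors, ringClassGalOver ι n (n / q) := by
  induction k using induction_on_primes with
  | zero => exact absurd (Nat.eq_zero_of_zero_dvd hk) hsq.ne_zero
  | one =>
    rw [Nat.div_one]
    exact ringClassGalOver_self_le ι n _
  | prime_mul q a hq ih =>
    have ha : a ∣ n := (Dvd.intro_left q rfl).trans hk
    have hqna : q ∣ n / a := by
      obtain ⟨c, hc⟩ := hk
      have ha0 : a ≠ 0 := fun h => hsq.ne_zero (by rw [hc, h]; ring)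
      refine ⟨c, ?_⟩
      rw [hc, show q * a * c = a * (q * c) by ring, Nat.mul_div_cancel_left _ (Nat.pos_of_ne_zero ha0)]
    have hdiv : n / a / q = n / (q * a) := by rw [Nat.div_div_eq_div_mul, mul_comm]
    have hstep := ringClassGalOver_div_le_sup_of_squarefree hK ι hsq hqna (Nat.div_dvd_of_dvd ha) hq
    rw [hdiv] at hstep
    refine hstep.trans (sup_le ?_ (ih ha))
    have hqn : q ∈ n.primeFactors :=
      Nat.mem_primeFactors.mpr ⟨hq, (Dvd.intro _ rfl).trans hk, hsq.ne_zero⟩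
    exact le_iSup₂_of_le (f := fun q _ => ringClassGalOver ι n (n / q)) q hqn le_rfl

/-- **`G_n = Gal(K[n]/K[1]) ≤ ⨆_{q ∣ n} G_q`** for `n` square-free: the Galois group of `K[n]`
over `K[1]` is generated by the subgroups `G_q = Gal(K[n]/K[n] ∩ K[n/q])`, `q` running over the
prime factors of `n` ("`G_n ≃ ∏ G_ℓ`", Gross 1991, §3; Zhang 2014, §3.7).
[cite: GrossLMS1991, §3 (chunk 217 L1)] [cite: WZhang2014, §3.7] -/
theorem ringClassGalOver_one_le_iSup (hK : IsImaginaryQuadratic K) (ι : K →+* ℂ) {n : ℕ}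
    (hsq : Squarefree n) :
    ringClassGalOver ι n 1 ≤ ⨆ q ∈ n.primeFactors, ringClassGalOver ι n (n / q) := by
  have h := ringClassGalOver_div_le_iSup hK ι hsq (dvd_refl n)
  rwa [Nat.div_self (Nat.pos_of_ne_zero hsq.ne_zero)] at h

end Summit.BirchSwinnertonDyer.Rank1Residual.X11b.RingClassTower

/-! ## §2 `hord`, `hgen`, `Tr_ℓ y_m ∈ p^M A₀ m`, McCallum's (4) and `hPt` at the divisors of a
Kolyvagin level, in the END's abstract-dictionary currency -/

namespace Summit.BirchSwinnertonDyer.Rank1Residual.X11b.KolyvaginH44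

-- `K : Type`: the tree's ring-class class field theory is universe `0`.
variable {K : Type} [Field K] [NumberField K]
variable {N : ℕ} {W : WeierstrassCurve ℚ}

/-- For `m` square-free and a prime `ℓ ∣ m`: `ℓ ∤ m/ℓ`. [folklore] -/
theorem not_dvd_div_of_squarefree_of_prime {m ℓ : ℕ} (hm : Squarefree m) (hℓ : ℓ.Prime)
    (hℓm : ℓ ∣ m) : ¬ ℓ ∣ m / ℓ := by
  intro h
  have : ℓ * ℓ ∣ m := by
    have := Nat.mul_dvd_mul_left ℓ h
    rwa [Nat.mul_div_cancel' hℓm] at this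
  exact hℓ.one_lt.ne' (Nat.isUnit_iff.mp (hm ℓ this))

/-- **The END binder `hord` at the divisors of `n`**: `σ_m ℓ ^ (ℓ + 1) = 1` for `m ∣ n`, `ℓ ∣ m`,
read back through the injective dictionary `ρ m (σ m ℓ) = σ_ℓ ∈ G_ℓ` (`KolyvaginHeegnerData.zpowers_σ`)
from `#G_ℓ ∣ ℓ + 1` on the concrete ring class tower (`RingClassTower.pow_succ_eq_one_of_mem_ringClassGalOver`;
Gross 1991, §3: "`G_ℓ` … cyclic of order `ℓ + 1`"). [cite: GrossLMS1991, §3 (chunk 217 L1)] -/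
theorem pow_succ_eq_one_of_dvd (hK : IsImaginaryQuadratic K) (ι : K →+* ℂ) [NeZero N]
    (Dt : ModularParametrizationData W N) {β : ℤ} {p : ℕ} {n : ℕ} (hn : Squarefree n)
    (hkol : ∀ q ∈ n.primeFactors, IsKolyvaginPrime N W K p q)
    (d : (m : ℕ) → m ∣ n → KolyvaginHeegnerData Dt β ι m)
    {𝒢 : ℕ → Type*} [∀ m, CommGroup (𝒢 m)] (σ : ∀ m, ℕ → 𝒢 m) (L : ℕ → Finset ℕ)
    (ρ : ∀ m, 𝒢 m →* (ringClassField K ι m ≃ₐ[ℚ] ringClassField K ι m))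
    (hρ : ∀ m, Function.Injective (ρ m))
    (hσA : ∀ (m : ℕ) (hm : m ∣ n), ∀ q ∈ m.primeFactors, ρ m (σ m q) = (d m hm).σ q)
    (hL : ∀ m : ℕ, m ∣ n → L m = m.primeFactors) :
    ∀ m : ℕ, m ∣ n → ∀ ℓ ∈ L m, σ m ℓ ^ (ℓ + 1) = 1 := by
  intro m hm ℓ hℓ
  have hm0 : m ≠ 0 := ne_zero_of_dvd_ne_zero hn.ne_zero hm
  rw [hL m hm] at hℓ
  obtain ⟨hℓp, hℓm, -⟩ := Nat.mem_primeFactors.mp hℓ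
  have hℓm' : ¬ ℓ ∣ m / ℓ := not_dvd_div_of_squarefree_of_prime (hn.squarefree_of_dvd hm) hℓp hℓm
  have hinert := (hkol ℓ (Nat.primeFactors_mono hm hn.ne_zero hℓ)).2.2.2.2.1
  have hmem : ρ m (σ m ℓ) ∈ ringClassGalOver ι m (m / ℓ) := by
    rw [hσA m hm ℓ hℓ, ← (d m hm).zpowers_σ ℓ hℓ]
    exact Subgroup.mem_zpowers _
  have h := RingClassTower.pow_succ_eq_one_of_mem_ringClassGalOver hK ι hm0 hℓp hℓm hℓm' hinert hmem
  exact hρ m (by rw [map_pow, h, map_one])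

/-- **The Euler hypothesis `hgen` at the divisors of `n`**: `H m ≤ ⟨σ_m ℓ : ℓ ∈ L m⟩` — printed
"`G_n ≃ ∏ G_ℓ`, `G_ℓ = ⟨σ_ℓ⟩`" (Gross 1991, §3) — for `m ∣ n` square-free, read back through the
injective dictionary (`hHρ : ρ m (H m) ≤ Gal(K[m]/K[1])`, `hσA`, `KolyvaginHeegnerData.zpowers_σ`)
from `RingClassTower.ringClassGalOver_one_le_iSup`. [cite: GrossLMS1991, §3 (chunk 217 L1)] -/
theorem le_closure_of_dvd (hK : IsImaginaryQuadratic K) (ι : K →+* ℂ) [NeZero N]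
    (Dt : ModularParametrizationData W N) {β : ℤ} {n : ℕ} (hn : Squarefree n)
    (d : (m : ℕ) → m ∣ n → KolyvaginHeegnerData Dt β ι m)
    {𝒢 : ℕ → Type*} [∀ m, CommGroup (𝒢 m)] (σ : ∀ m, ℕ → 𝒢 m) (L : ℕ → Finset ℕ)
    (H : ∀ m, Subgroup (𝒢 m))
    (ρ : ∀ m, 𝒢 m →* (ringClassField K ι m ≃ₐ[ℚ] ringClassField K ι m))
    (hρ : ∀ m, Function.Injective (ρ m))
    (hσA : ∀ (m : ℕ) (hm : m ∣ n), ∀ q ∈ m.primeFactors, ρ m (σ m q) = (d m hm).σ q)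
    (hL : ∀ m : ℕ, m ∣ n → L m = m.primeFactors)
    (hHρ : ∀ m : ℕ, m ∣ n → ∀ h ∈ H m, ρ m h ∈ ringClassGalOver ι m 1) :
    ∀ m : ℕ, m ∣ n → H m ≤ Subgroup.closure (σ m '' (L m : Set ℕ)) := by
  intro m hm h hh
  have hmsq : Squarefree m := hn.squarefree_of_dvd hm
  have h1 := RingClassTower.ringClassGalOver_one_le_iSup hK ι hmsq (hHρ m hm h hh)
  have h2 : (⨆ q ∈ m.primeFactors, ringClassGalOver ι m (m / q)) ≤
      (Subgroup.closure (σ m '' (L m : Set ℕ))).map (ρ m) := by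
    refine iSup₂_le fun q hq => ?_
    rw [← (d m hm).zpowers_σ q hq, ← hσA m hm q hq, ← MonoidHom.map_zpowers]
    exact Subgroup.map_mono (Subgroup.zpowers_le.mpr
      (Subgroup.subset_closure ⟨q, by rw [hL m hm]; exact hq, rfl⟩))
  obtain ⟨g, hg, hgh⟩ := Subgroup.mem_map.mp (h2 h1)
  rwa [← hρ m hgh]

/-- **`Tr_ℓ y_m ∈ p^M A₀ m` at the divisors of a Kolyvagin level of level `M`** ((β2) + (3.3)): for
`m ∣ n`, `ℓ ∣ m`, with every prime factor of `n` a Kolyvagin prime `q` of level `M`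
(`Frob(q) = Frob(∞)` on `E[p^M]`) and `d_K < −4`: `Tr_ℓ y(m) = a_ℓ · y(m/ℓ)↑` in `E(K[m])` (Gross Prop.
3.7 (1), x11b3-p2's `HeegnerTrace.sum_pow_pointGalHom_y_eq_lFunction_smul_map`) and `p^M ∣ a_ℓ`
(Gross (3.3), `pow_dvd_frobeniusTraceAt_of_frobEqFrobInfty`), transferred to `A₀ m` along the
equivariant `iA m` (the pattern of x11b3-p8's bridge).
[cite: GrossLMS1991, Prop. 3.7 (1), §3 (3.3)] [cite: McCallumLMS1991, §4 (p. 281)] -/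
theorem grAct_traceElt_mem_of_dvd (hK : IsImaginaryQuadratic K) (ι : K →+* ℂ) [NeZero N]
    [W.IsElliptic] [W.IsGloballyMinimal] (Dt : ModularParametrizationData W N) {β : ℤ} {p M : ℕ}
    (hp : p.Prime) (hM : 1 ≤ M)
    (hND : IsCoprime (N : ℤ) (NumberField.discr K)) (hD : NumberField.discr K < -4) {n : ℕ}
    (hn : Squarefree n)
    (hkol : ∀ q ∈ n.primeFactors, IsKolyvaginPrime N W K p q ∧ FrobEqFrobInfty W K (p ^ M) q)
    (d : (m : ℕ) → m ∣ n → KolyvaginHeegnerData Dt β ι m)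
    {𝒢 : ℕ → Type*} [∀ m, CommGroup (𝒢 m)] {A₀ : ℕ → Type*} [∀ m, AddCommGroup (A₀ m)]
    [∀ m, DistribMulAction (𝒢 m) (A₀ m)]
    (σ : ∀ m, ℕ → 𝒢 m) (L : ℕ → Finset ℕ) (y : ∀ m, A₀ m)
    (ρ : ∀ m, 𝒢 m →* (ringClassField K ι m ≃ₐ[ℚ] ringClassField K ι m))
    (iA : ∀ m, A₀ m ≃+ (W.baseChange (ringClassField K ι m)).toAffine.Point)
    (hiA : ∀ (m : ℕ), m ∣ n → ∀ (g : 𝒢 m) (a : A₀ m),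
      iA m (g • a) = pointGalHom W (ringClassField K ι m) (ρ m g) (iA m a))
    (hyA : ∀ (m : ℕ) (hm : m ∣ n), iA m (y m) = (d m hm).y)
    (hσA : ∀ (m : ℕ) (hm : m ∣ n), ∀ q ∈ m.primeFactors, ρ m (σ m q) = (d m hm).σ q)
    (hL : ∀ m : ℕ, m ∣ n → L m = m.primeFactors) :
    ∀ m : ℕ, m ∣ n → ∀ ℓ ∈ L m,
      grAct (A₀ m) (traceElt (σ m ℓ) ℓ) (y m) ∈ zsmulRange (A₀ m) ((p ^ M : ℕ) : ℤ) := by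
  intro m hm ℓ hℓ
  have hn0 := hn.ne_zero
  have hm0 : m ≠ 0 := ne_zero_of_dvd_ne_zero hn0 hm
  rw [hL m hm] at hℓ
  obtain ⟨hℓp, hℓm, -⟩ := Nat.mem_primeFactors.mp hℓ
  obtain ⟨hℓK, hℓM⟩ := hkol ℓ (Nat.primeFactors_mono hm hn0 hℓ)
  have hℓm' : ¬ ℓ ∣ m / ℓ := not_dvd_div_of_squarefree_of_prime (hn.squarefree_of_dvd hm) hℓp hℓm
  have hm' : m / ℓ ∣ n := (Nat.div_dvd_of_dvd hℓm).trans hm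
  have hle : ringClassField K ι (m / ℓ) ≤ ringClassField K ι m :=
    ringClassField_mono hK ι (Nat.div_dvd_of_dvd hℓm) hm0
  have hNm : Nat.Coprime N m := KolyvaginH37Bridge.coprime_of_forall_not_dvd hm0
    fun q hq => (hkol q (Nat.primeFactors_mono hm hn0 hq)).1.2.1
  haveI : Fact ℓ.Prime := ⟨hℓp⟩
  -- (β2): Gross Prop. 3.7 (1) for the tree's data, in `a_ℓ = W.frobeniusTrace ℓ` currency
  have hgood : W.HasGoodReductionAtPrime ℓ :=
    KolyvaginH37Bridge.hasGoodReductionAtPrime_of_modularParametrizationData Dt hℓK.2.1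
  have htr := HeegnerTrace.frobeniusTrace_smul_eq_of_lFunction_smul_eq hgood
    (HeegnerTrace.sum_pow_pointGalHom_y_eq_lFunction_smul_map hK ι hND hℓ hℓK.2.2.2.2.1 hℓK.2.1
      hℓm' hNm (Or.inr hD) (d m hm) (d (m / ℓ) hm') hle)
  -- (3.3): `p^M ∣ a_ℓ`
  obtain ⟨v₀, hv₀, hℓv₀⟩ := exists_ratPlace ℓ
  have hgood₀ : W.HasGoodReductionAt v₀ :=
    hasGoodReductionAt_of_isNewformOf_of_not_dvd W Dt.isNewformOf hℓp hℓK.2.1 v₀ hℓv₀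
  have haℓ : ((p ^ M : ℕ) : ℤ) ∣ W.frobeniusTrace ℓ := by
    have h := pow_dvd_frobeniusTraceAt_of_frobEqFrobInfty W (K := K) hp hM hℓp hℓK.2.2.2.1 hℓM
      hℓv₀ hgood₀
    rw [frobeniusTraceAt_eq_frobeniusTrace W v₀, show ((Rat.HeightOneSpectrum.primesEquiv v₀ : ℕ)) = ℓ from hv₀] at h
    exact_mod_cast h
  -- transfer to `A₀ m` along the injective equivariant `iA m`
  have hrel : grAct (A₀ m) (traceElt (σ m ℓ) ℓ) (y m) =
      W.frobeniusTrace ℓ • (iA m).symm (WeierstrassCurve.Affine.Point.map (W' := W)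
        ((RingClassField.inclusion ι hle).restrictScalars ℚ) (d (m / ℓ) hm').y) := by
    apply (iA m).injective
    rw [grAct_traceElt, map_sum, map_zsmul, AddEquiv.apply_symm_apply]
    simp_rw [hiA m hm, map_pow (ρ m), hσA m hm ℓ hℓ, hyA m hm]
    exact htr
  exact grAct_traceElt_mem_of_eq_smul hrel haℓ

/-- **McCallum's (4) / Gross's Prop. 3.6 at the divisors of a Kolyvagin level of level `M`**:
`γ P_m − P_m ∈ p^M A₀ m` for every `γ ∈ 𝒢_m` and every `m ∣ n` — *"By Proposition 3.6, the class
`[P_n]` in `E(K_n)/p E(K_n)` is fixed by `𝒢_n`"* — for the tree's concrete data read in the abstract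
module `A₀ m` through the dictionary; the tree's group-ring algebra
`KolyvaginEuler.smul_kolyvaginPoint_sub_mem` fed with `hfsec`, `le_closure_of_dvd` (`hgen`),
`pow_succ_eq_one_of_dvd` (`hord`), `IsKolyvaginPrime.pow_dvd_add_one` (`hdvd`) and
`grAct_traceElt_mem_of_dvd` (`htr`). [cite: GrossLMS1991, Prop. 3.6, §4 (4.1)]
[cite: McCallumLMS1991, §4 (4)] -/
theorem smul_kolyvaginPoint_sub_mem_of_dvd (hK : IsImaginaryQuadratic K) (ι : K →+* ℂ) [NeZero N]
    [W.IsElliptic] [W.IsGloballyMinimal] (Dt : ModularParametrizationData W N) {β : ℤ} {p M : ℕ}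
    (hp : p.Prime) (hM : 1 ≤ M)
    (hND : IsCoprime (N : ℤ) (NumberField.discr K)) (hD : NumberField.discr K < -4) {n : ℕ}
    (hn : Squarefree n)
    (hkol : ∀ q ∈ n.primeFactors, IsKolyvaginPrime N W K p q ∧ FrobEqFrobInfty W K (p ^ M) q)
    (d : (m : ℕ) → m ∣ n → KolyvaginHeegnerData Dt β ι m)
    {𝒢 : ℕ → Type*} [∀ m, CommGroup (𝒢 m)] {A₀ : ℕ → Type*} [∀ m, AddCommGroup (A₀ m)]
    [∀ m, DistribMulAction (𝒢 m) (A₀ m)]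
    (σ : ∀ m, ℕ → 𝒢 m) (L : ℕ → Finset ℕ) (H : ∀ m, Subgroup (𝒢 m))
    [∀ m, Fintype (𝒢 m ⧸ H m)] (f : ∀ m, 𝒢 m ⧸ H m → 𝒢 m) (y : ∀ m, A₀ m)
    (ρ : ∀ m, 𝒢 m →* (ringClassField K ι m ≃ₐ[ℚ] ringClassField K ι m))
    (hρ : ∀ m, Function.Injective (ρ m))
    (iA : ∀ m, A₀ m ≃+ (W.baseChange (ringClassField K ι m)).toAffine.Point)
    (hiA : ∀ (m : ℕ), m ∣ n → ∀ (g : 𝒢 m) (a : A₀ m),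
      iA m (g • a) = pointGalHom W (ringClassField K ι m) (ρ m g) (iA m a))
    (hyA : ∀ (m : ℕ) (hm : m ∣ n), iA m (y m) = (d m hm).y)
    (hσA : ∀ (m : ℕ) (hm : m ∣ n), ∀ q ∈ m.primeFactors, ρ m (σ m q) = (d m hm).σ q)
    (hL : ∀ m : ℕ, m ∣ n → L m = m.primeFactors)
    (hfsec : ∀ m : ℕ, m ∣ n → ∀ c : 𝒢 m ⧸ H m, (f m c : 𝒢 m ⧸ H m) = c)
    (hHρ : ∀ m : ℕ, m ∣ n → ∀ h ∈ H m, ρ m h ∈ ringClassGalOver ι m 1) :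
    ∀ m : ℕ, m ∣ n → ∀ γ : 𝒢 m,
      γ • kolyvaginPoint (σ m) (L m) (f m) (y m) - kolyvaginPoint (σ m) (L m) (f m) (y m) ∈
        zsmulRange (A₀ m) ((p ^ M : ℕ) : ℤ) := by
  intro m hm γ
  have hdvd : ∀ ℓ ∈ L m, ((p ^ M : ℕ) : ℤ) ∣ ((ℓ + 1 : ℕ) : ℤ) := by
    intro ℓ hℓ
    rw [hL m hm] at hℓ
    obtain ⟨hℓK, hℓM⟩ := hkol ℓ (Nat.primeFactors_mono hm hn.ne_zero hℓ)
    exact (IsKolyvaginPrime.pow_dvd_add_one W hp hℓK hM hℓM).1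
  exact smul_kolyvaginPoint_sub_mem (hfsec m hm)
    (le_closure_of_dvd hK ι Dt hn d σ L H ρ hρ hσA hL hHρ m hm)
    (pow_succ_eq_one_of_dvd hK ι Dt hn (fun q hq => (hkol q hq).1) d σ L ρ hρ hσA hL m hm)
    hdvd
    (grAct_traceElt_mem_of_dvd hK ι Dt hp hM hND hD hn hkol d σ L y ρ iA hiA hyA hσA hL m hm) γ

/-- **The END binder `hPt` at the divisors of a Kolyvagin level of level `M`** — McCallum's (4)
`[P_m] ∈ (E(K_m)/p^M E(K_m))^{𝒢_m}` in `E(K̄)`: `j_m P_m ∈ invPoints Γ_K (j_m A₀ m) p^M`, the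
hypothesis of McCallum's cocycle `kolyvaginClass` and the text of the binder `hPt m` of
`h44_of_traceRelation_of_congruence_of_dvd` verbatim, at every `m ∣ n` — from
`smul_kolyvaginPoint_sub_mem_of_dvd` and the equivariance of `j m` along `π m`
(`KolyvaginEuler.map_mem_invPoints_of_forall_smul_sub_mem`).  HONEST: plumbing; SUPPLIES `hPt`
(with `pow_succ_eq_one_of_dvd`: `hord`) for concrete data at a Kolyvagin level from (β2) + (3.3) +
"`G_m ≃ ∏ G_ℓ`", all tree theorems; `h44` / (γ) / `h37`-in-general NOT discharged; `hA` / `hI`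
untouched; nothing `p = 3`-specific; nothing booked. [cite: McCallumLMS1991, §4 (4)]
[cite: GrossLMS1991, Prop. 3.6, §4 (4.1)] -/
theorem kolyvaginPoint_mem_invPoints_of_dvd (hK : IsImaginaryQuadratic K) (ι : K →+* ℂ)
    [NeZero N] [W.IsElliptic] [W.IsGloballyMinimal] (Dt : ModularParametrizationData W N) {β : ℤ}
    {p M : ℕ} (hp : p.Prime) (hM : 1 ≤ M)
    (hND : IsCoprime (N : ℤ) (NumberField.discr K)) (hD : NumberField.discr K < -4) {n : ℕ}
    (hn : Squarefree n)
    (hkol : ∀ q ∈ n.primeFactors, IsKolyvaginPrime N W K p q ∧ FrobEqFrobInfty W K (p ^ M) q)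
    (d : (m : ℕ) → m ∣ n → KolyvaginHeegnerData Dt β ι m)
    {𝒢 : ℕ → Type*} [∀ m, CommGroup (𝒢 m)] {A₀ : ℕ → Type*} [∀ m, AddCommGroup (A₀ m)]
    [∀ m, DistribMulAction (𝒢 m) (A₀ m)]
    (σ : ∀ m, ℕ → 𝒢 m) (L : ℕ → Finset ℕ) (H : ∀ m, Subgroup (𝒢 m))
    [∀ m, Fintype (𝒢 m ⧸ H m)] (f : ∀ m, 𝒢 m ⧸ H m → 𝒢 m) (y : ∀ m, A₀ m)
    (π : ∀ m, absoluteGaloisGroup K →* 𝒢 m) (j : ∀ m, A₀ m →+ geomPoints (W.baseChange K))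
    (hj : ∀ m (g : absoluteGaloisGroup K) (a : A₀ m), j m (π m g • a) = g • j m a)
    (ρ : ∀ m, 𝒢 m →* (ringClassField K ι m ≃ₐ[ℚ] ringClassField K ι m))
    (hρ : ∀ m, Function.Injective (ρ m))
    (iA : ∀ m, A₀ m ≃+ (W.baseChange (ringClassField K ι m)).toAffine.Point)
    (hiA : ∀ (m : ℕ), m ∣ n → ∀ (g : 𝒢 m) (a : A₀ m),
      iA m (g • a) = pointGalHom W (ringClassField K ι m) (ρ m g) (iA m a))
    (hyA : ∀ (m : ℕ) (hm : m ∣ n), iA m (y m) = (d m hm).y)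
    (hσA : ∀ (m : ℕ) (hm : m ∣ n), ∀ q ∈ m.primeFactors, ρ m (σ m q) = (d m hm).σ q)
    (hL : ∀ m : ℕ, m ∣ n → L m = m.primeFactors)
    (hfsec : ∀ m : ℕ, m ∣ n → ∀ c : 𝒢 m ⧸ H m, (f m c : 𝒢 m ⧸ H m) = c)
    (hHρ : ∀ m : ℕ, m ∣ n → ∀ h ∈ H m, ρ m h ∈ ringClassGalOver ι m 1) :
    ∀ m : ℕ, m ∣ n →
      j m (kolyvaginPoint (σ m) (L m) (f m) (y m)) ∈
        invPoints (absoluteGaloisGroup K) (j m).range ((p ^ M : ℕ) : ℤ) :=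
  fun m hm => map_mem_invPoints_of_forall_smul_sub_mem (π m) (j m) (hj m)
    (smul_kolyvaginPoint_sub_mem_of_dvd hK ι Dt hp hM hND hD hn hkol d σ L H f y ρ hρ iA hiA hyA
      hσA hL hfsec hHρ m hm)

end Summit.BirchSwinnertonDyer.Rank1Residual.X11b.KolyvaginH44

end
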